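import Summits.QuantumAdvantage.AdviceFreeQNC0.AugmentedCode
import HarnessLib

/-!
# Cell qa-qnc0 (rung F-Q1, route RingFrame, crux α, line `tensor`): the union-bound form of
# STRICT-U suffices — `UnionBound → LiftOneStrict` (qn-p2 ROUND-3 §2(a) Lemma 1, ask P2-2)

Planner qa-qnc0-p2's `line/Sketch3.lean` (ROUND-3 of the tensor line of crux `RingToElim`) fixes the
first open rung S1 = CONJECTURE STRICT-U (`LiftOneStrict`: strictly inside the unique-decoding radius,
a matrix with LINEAR columns whose rows are `w`-close to `RM(d, L')` is `K·w·2^L`-close to a matrix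
with linear columns AND degree-`d` rows) and its union-bound form `UnionBound` (the columns where `X`
differs from its row-wise decoding `Y` number at most `K·w`).  This file types that vocabulary VERBATIM
(`ColsDeg`, `RowsDeg`, `rowDist`, `LinCols`, `LiftOneStrict`, `colDiff`, `UnionBound`; `hw`, `xorM`,
`HasDeg` are the topic's, same bodies) and PROVES the routine implication

* `unionBoundSuffices : UnionBound → LiftOneStrict` (= `Sketch3.UnionBoundSuffices`):

lift through the basis rows — `basisLift Y u v := ⨁_{i : u i} Y eᵢ v` has linear columns
(`linCols_basisLift`) and degree-`d` rows (`rowsDeg_basisLift`), and agrees with `X` on every column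
off `D₀ = colDiff X Y` because the columns of `X` are linear (`apply_eq_sum_basis_of_linCols`:
a degree-`≤ 1` polynomial over `𝔽₂` vanishing at `0` is the sum of its values on the basis vectors in
the support, `eq_affine_of_mem_lowDeg_one`); hence `hw (X ⊕ W) ≤ 2^L·|D₀| ≤ K·w·2^L`
(`hw_xorM_basisLift_le`).

WHAT THIS IS NOT: `UnionBound` / STRICT-U are qn-p2's CONJECTURES (open; kit evidence ROUND-3 §4);
nothing here bears on `TRPlus`, `RingToElim`, `RingHard 2` or the rung leaf.
-/

namespace Summit.QuantumAdvantage.AdviceFreeQNC0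

open Finset
open Literature.Computability.MetaComplexity Literature.Computability.MetaComplexity.Smolensky

/-! ### Vocabulary (verbatim from qn-p2 `line/Sketch3.lean`) -/

/-- every column is a `GF(2)`-polynomial of degree `≤ d` on `{0,1}^L`. -/
def ColsDeg {L L' : ℕ} (d : ℕ) (X : (Fin L → Bool) → (Fin L' → Bool) → Bool) : Prop :=
  ∀ v, HasDeg (fun u => X u v) d

/-- every row is a `GF(2)`-polynomial of degree `≤ d` on `{0,1}^{L'}` (plain `RM(d,L')`). -/
def RowsDeg {L L' : ℕ} (d : ℕ) (X : (Fin L → Bool) → (Fin L' → Bool) → Bool) : Prop :=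
  ∀ u, HasDeg (fun v => X u v) d

/-- Hamming distance between row `u` of `X` and row `u` of `Y`. -/
def rowDist {L L' : ℕ} (X Y : (Fin L → Bool) → (Fin L' → Bool) → Bool) (u : Fin L → Bool) : ℕ :=
  (univ.filter fun v : Fin L' → Bool => X u v ≠ Y u v).card

/-- LINEAR columns (affine of degree `≤ 1` and vanishing at the zero row). -/
def LinCols {L L' : ℕ} (X : (Fin L → Bool) → (Fin L' → Bool) → Bool) : Prop :=
  ColsDeg 1 X ∧ ∀ v, X (fun _ => false) v = false

/-- **S1 — CONJECTURE STRICT-U** (qn-p2 `Sketch2`/`Sketch3.LiftOneStrict`, verbatim): strictly inside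
the unique-decoding radius (`2w < 2^{L'−d}`), a matrix with linear columns whose rows are `w`-close to
`RM(d, L')` is `K·w·2^L`-close to a matrix with linear columns and degree-`d` rows, `K` absolute.
OPEN. -/
def LiftOneStrict : Prop :=
  ∃ K : ℝ, 0 < K ∧ ∀ L L' d w : ℕ, 2 * w < 2 ^ (L' - d) →
    ∀ X Y : (Fin L → Bool) → (Fin L' → Bool) → Bool, LinCols X → RowsDeg d Y → (∀ u, rowDist X Y u ≤ w) →
      ∃ W : (Fin L → Bool) → (Fin L' → Bool) → Bool, LinCols W ∧ RowsDeg d W ∧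
        (hw (xorM X W) : ℝ) ≤ K * w * (2 : ℝ) ^ L

/-- `D₀(X,Y)`: the columns in which `X` and `Y` differ in at least one row (the union of the coset
leaders `a_u = X(u,·) + Y(u,·)`; qn-p2 ROUND-3 §1). -/
def colDiff {L L' : ℕ} (X Y : (Fin L → Bool) → (Fin L' → Bool) → Bool) : Finset (Fin L' → Bool) :=
  univ.filter fun v : Fin L' → Bool => ∃ u, X u v ≠ Y u v

/-- **CONJECTURE UB (union bound)** (qn-p2 ROUND-3 §2, `Sketch3.UnionBound` verbatim): strictly inside
the unique-decoding radius the coset leaders of a light syndrome subspace of `𝔽^V/RM(d,L')` cover at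
most `K·w` points, `K` absolute. OPEN. -/
def UnionBound : Prop :=
  ∃ K : ℝ, 0 < K ∧ ∀ L L' d w : ℕ, 2 * w < 2 ^ (L' - d) →
    ∀ X Y : (Fin L → Bool) → (Fin L' → Bool) → Bool, LinCols X → RowsDeg d Y → (∀ u, rowDist X Y u ≤ w) →
      ((colDiff X Y).card : ℝ) ≤ K * w

/-! ### Degree-`≤ 1` polynomials over `𝔽₂` are affine -/

/-- The `i`-th basis row `eᵢ`. -/
def basisRow {L : ℕ} (i : Fin L) : Fin L → Bool := fun j => decide (j = i)

/-- `(1 : 𝔽₂) + 1 = 0`. -/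
private theorem one_add_one_zmod2 : (1 : ZMod 2) + 1 = 0 := by decide

/-- A degree-`≤ 1` polynomial over `𝔽₂` is AFFINE:
`g u = g 0 + Σ_i [u i]·(g eᵢ + g 0)`. [folklore] -/
theorem eq_affine_of_mem_lowDeg_one {n : ℕ} {g : CubeFn (ZMod 2) n} (hg : g ∈ lowDeg (ZMod 2) n 1)
    (u : Fin n → Bool) :
    g u = g (fun _ => false) +
      ∑ i, (if u i = true then (1 : ZMod 2) else 0) * (g (basisRow i) + g (fun _ => false)) := by
  rw [lowDeg_eq_span] at hg
  induction hg using Submodule.span_induction with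
  | mem f hf =>
      obtain ⟨⟨S, hS⟩, rfl⟩ := hf
      rcases S.eq_empty_or_nonempty with hSe | hSne
      · subst hSe
        simp only [mono_empty, Pi.one_apply, one_add_one_zmod2, mul_zero, Finset.sum_const_zero,
          add_zero]
      · obtain ⟨j, rfl⟩ := Finset.card_eq_one.1 (le_antisymm hS (Finset.card_pos.2 hSne))
        simp only [mono_apply, Finset.mem_singleton, forall_eq, basisRow, decide_eq_true_eq,
          Bool.false_eq_true, if_false, zero_add, add_zero]
        rw [Finset.sum_eq_single j]
        · by_cases h : u j = true
          · simp [h]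
          · simp [h]
        · intro i _ hij
          rw [if_neg (Ne.symm hij), mul_zero]
        · intro h
          exact absurd (Finset.mem_univ j) h
  | zero => simp
  | add f f' _ _ hf hf' =>
      rw [Pi.add_apply, hf, hf']
      simp only [Pi.add_apply, mul_add, Finset.sum_add_distrib]
      ring
  | smul a f _ hf =>
      rw [Pi.smul_apply, hf]
      simp only [Pi.smul_apply, smul_eq_mul]
      ring_nf
      rw [Finset.mul_sum]
      refine congrArg _ (Finset.sum_congr rfl fun i _ => ?_)
      ring

/-- The `𝔽₂`-indicator is injective on `Bool`. -/
private theorem bool_eq_of_indicator_eq :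
    ∀ a b : Bool, (if a = true then (1 : ZMod 2) else 0) = (if b = true then (1 : ZMod 2) else 0) →
      a = b := by
  decide

/-- `[decide (z = 1)] = z` in `𝔽₂`. -/
private theorem indicator_decide_eq_one (z : ZMod 2) :
    (if decide (z = 1) = true then (1 : ZMod 2) else 0) = z := by
  revert z; decide

/-- **A linear column is the sum of its values on the basis rows in the support**:
`[X u v] = Σ_i [u i]·[X eᵢ v]` in `𝔽₂`. -/
theorem apply_eq_sum_basis_of_linCols {L L' : ℕ} {X : (Fin L → Bool) → (Fin L' → Bool) → Bool}
    (hX : LinCols X) (u : Fin L → Bool) (v : Fin L' → Bool) :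
    (if X u v = true then (1 : ZMod 2) else 0) =
      ∑ i, (if u i = true then (1 : ZMod 2) else 0) *
        (if X (basisRow i) v = true then (1 : ZMod 2) else 0) := by
  have h := eq_affine_of_mem_lowDeg_one (hX.1 v) u
  simp only [hX.2 v, Bool.false_eq_true, if_false, zero_add, add_zero] at h
  exact h

/-! ### The basis lift -/

/-- **The basis lift** `W u v := ⨁_{i : u i} Y eᵢ v` (qn-p2 ROUND-3 §2(a) Lemma 1). -/
def basisLift {L L' : ℕ} (Y : (Fin L → Bool) → (Fin L' → Bool) → Bool) :
    (Fin L → Bool) → (Fin L' → Bool) → Bool :=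
  fun u v => decide ((∑ i, (if u i = true then (1 : ZMod 2) else 0) *
    (if Y (basisRow i) v = true then (1 : ZMod 2) else 0)) = 1)

/-- The `𝔽₂`-indicator of the basis lift is the defining sum. -/
theorem indicator_basisLift {L L' : ℕ} (Y : (Fin L → Bool) → (Fin L' → Bool) → Bool)
    (u : Fin L → Bool) (v : Fin L' → Bool) :
    (if basisLift Y u v = true then (1 : ZMod 2) else 0) =
      ∑ i, (if u i = true then (1 : ZMod 2) else 0) *
        (if Y (basisRow i) v = true then (1 : ZMod 2) else 0) :=
  indicator_decide_eq_one _

/-- The basis lift has LINEAR columns. -/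
theorem linCols_basisLift {L L' : ℕ} (Y : (Fin L → Bool) → (Fin L' → Bool) → Bool) :
    LinCols (basisLift Y) := by
  refine ⟨fun v => ?_, fun v => ?_⟩
  · show (fun u => if basisLift Y u v = true then (1 : ZMod 2) else 0) ∈ lowDeg (ZMod 2) L 1
    have hfun : (fun u => if basisLift Y u v = true then (1 : ZMod 2) else 0) =
        ∑ i, (if Y (basisRow i) v = true then (1 : ZMod 2) else 0) • mono (ZMod 2) ({i} : Finset (Fin L)) := by
      funext u
      rw [indicator_basisLift, Finset.sum_apply]
      refine Finset.sum_congr rfl fun i _ => ?_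
      rw [Pi.smul_apply, smul_eq_mul, mono_apply]
      simp only [Finset.mem_singleton, forall_eq]
      ring
    rw [hfun]
    exact Submodule.sum_mem _ fun i _ =>
      Submodule.smul_mem _ _ (mono_mem_lowDeg (by rw [Finset.card_singleton]))
  · unfold basisLift
    simp

/-- The basis lift of a matrix with degree-`d` rows has degree-`d` rows. -/
theorem rowsDeg_basisLift {L L' d : ℕ} {Y : (Fin L → Bool) → (Fin L' → Bool) → Bool}
    (hY : RowsDeg d Y) : RowsDeg d (basisLift Y) := by
  intro u
  show (fun v => if basisLift Y u v = true then (1 : ZMod 2) else 0) ∈ lowDeg (ZMod 2) L' d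
  have hfun : (fun v => if basisLift Y u v = true then (1 : ZMod 2) else 0) =
      ∑ i, (if u i = true then (1 : ZMod 2) else 0) •
        (fun v => if Y (basisRow i) v = true then (1 : ZMod 2) else 0) := by
    funext v
    rw [indicator_basisLift, Finset.sum_apply]
    refine Finset.sum_congr rfl fun i _ => ?_
    rw [Pi.smul_apply, smul_eq_mul]
  rw [hfun]
  exact Submodule.sum_mem _ fun i _ => Submodule.smul_mem _ _ (hY (basisRow i))

/-- Off `D₀ = colDiff X Y` the basis lift of `Y` agrees with `X` (the columns of `X` are linear). -/
theorem basisLift_eq_of_notMem_colDiff {L L' : ℕ} {X Y : (Fin L → Bool) → (Fin L' → Bool) → Bool}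
    (hX : LinCols X) {v : Fin L' → Bool} (hv : v ∉ colDiff X Y) (u : Fin L → Bool) :
    basisLift Y u v = X u v := by
  have hcol : ∀ u', X u' v = Y u' v := by
    intro u'
    by_contra h
    exact hv (Finset.mem_filter.2 ⟨Finset.mem_univ _, u', h⟩)
  apply bool_eq_of_indicator_eq
  rw [indicator_basisLift, apply_eq_sum_basis_of_linCols hX u v]
  exact Finset.sum_congr rfl fun i _ => by rw [hcol (basisRow i)]

/-- **`hw (X ⊕ W) ≤ 2^L·|D₀|`** for the basis lift `W` of the row-wise decoding `Y`. -/
theorem hw_xorM_basisLift_le {L L' : ℕ} {X Y : (Fin L → Bool) → (Fin L' → Bool) → Bool}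
    (hX : LinCols X) : hw (xorM X (basisLift Y)) ≤ 2 ^ L * (colDiff X Y).card := by
  unfold hw
  calc (univ.filter fun p : (Fin L → Bool) × (Fin L' → Bool) =>
          xorM X (basisLift Y) p.1 p.2 = true).card
      ≤ ((univ : Finset (Fin L → Bool)) ×ˢ colDiff X Y).card := by
        refine Finset.card_le_card fun p hp => ?_
        rw [Finset.mem_filter] at hp
        rw [Finset.mem_product]
        refine ⟨Finset.mem_univ _, ?_⟩
        by_contra hv
        have h := basisLift_eq_of_notMem_colDiff hX hv p.1
        have h2 := hp.2
        unfold xorM at h2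
        rw [h, Bool.xor_self] at h2
        exact Bool.false_ne_true h2
    _ = 2 ^ L * (colDiff X Y).card := by
        rw [Finset.card_product, Finset.card_univ, Fintype.card_fun, Fintype.card_bool,
          Fintype.card_fin]

/-! ### `UnionBound → LiftOneStrict` -/

/-- **`UnionBoundSuffices`** (qn-p2 `Sketch3.UnionBoundSuffices`, ROUND-3 §2(a) Lemma 1): the
union-bound conjecture implies CONJECTURE STRICT-U with the same constant `K` — lift through the
basis rows. -/
theorem unionBoundSuffices : UnionBound → LiftOneStrict := by
  rintro ⟨K, hK, hUB⟩
  refine ⟨K, hK, fun L L' d w hw2 X Y hX hY hdist => ?_⟩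
  refine ⟨basisLift Y, linCols_basisLift Y, rowsDeg_basisLift hY, ?_⟩
  have h1 : (hw (xorM X (basisLift Y)) : ℝ) ≤ (2 : ℝ) ^ L * ((colDiff X Y).card : ℝ) := by
    exact_mod_cast hw_xorM_basisLift_le (Y := Y) hX
  have h2 := hUB L L' d w hw2 X Y hX hY hdist
  have h3 : (2 : ℝ) ^ L * ((colDiff X Y).card : ℝ) ≤ (2 : ℝ) ^ L * (K * w) :=
    mul_le_mul_of_nonneg_left h2 (by positivity)
  calc (hw (xorM X (basisLift Y)) : ℝ) ≤ (2 : ℝ) ^ L * (K * w) := h1.trans h3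
    _ = K * w * (2 : ℝ) ^ L := by ring

end Summit.QuantumAdvantage.AdviceFreeQNC0
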